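import Mathlib

/-!
Sketch for crux-ideate stmt-CriticalPhenomena-4800 (StableConeRPRigidity), ideator 3, round 1.
First lemmas of the two idea cards; statements only (Props), no proofs.
-/

namespace Summit.CriticalPhenomena.Ising3DConformalLimit.Cruxes.StableConeRPRigidity.Sketch

open scoped BigOperators Real
open MeasureTheory

/-- Card `pick-half-strip-entire-profile`, FIRST LEMMA (pure one-variable function theory; the
heart of the lever).  `p` is the angular profile of the stable symbol `ψ_Φ` on a great circle that
contains two mirror traces at 45° (a coordinate plane); `F a` is the complete-Bernstein (= Pick on
the slit plane, nonnegative on the positive axis) continuation of the mirror section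
`s ↦ ψ_Φ(√s·n_a + q̂) = (1+s)^{α/2} p(a + arctan (1/√s))` for the two axes `a = 0` and `a = π/4`.
Conclusion: `p` is constant.  (Mechanism: `s = cot² χ` maps the slit plane onto the strip
`0 < Re χ < π/2`; two non-perpendicular axes make `p` entire and `π`-periodic with
`|p(x+iy)| ≤ C e^{(2+α)|y|}`, `2+α < 4`, so only the Fourier modes `1, cos 2χ` survive, and evenness
about `π/4` kills `cos 2χ`.) -/
def TwoTraceProfileRigidity : Prop :=
  ∀ (α : ℝ) (p : ℝ → ℝ) (F : ℝ → ℂ → ℂ), 1 ≤ α → α < 2 → Continuous p →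
    (∀ x, p (x + π) = p x) → (∀ x, p (-x) = p x) → (∀ x, p (π / 2 - x) = p x) →
    (∀ a ∈ ({0, π / 4} : Set ℝ),
      DifferentiableOn ℂ (F a) Complex.slitPlane ∧
      (∀ z : ℂ, 0 < z.im → 0 ≤ (F a z).im) ∧
      (∀ s : ℝ, 0 < s →
        F a (s : ℂ) = (((1 + s) ^ (α / 2) * p (a + Real.arctan (1 / Real.sqrt s)) : ℝ) : ℂ))) →
    ∀ x y, p x = p y

/-- Same lever, 60° version (the four `hexagonal' great circles `(±1,±1,±1)^⊥`, whose mirror traces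
are the three normals of type `e_i - e_j` at mutual angle `π/3`). -/
def ThreeTraceProfileRigidity : Prop :=
  ∀ (α : ℝ) (p : ℝ → ℝ) (F : ℝ → ℂ → ℂ), 1 ≤ α → α < 2 → Continuous p →
    (∀ x, p (x + π) = p x) → (∀ x, p (-x) = p x) → (∀ x, p (2 * π / 3 - x) = p x) →
    (∀ a ∈ ({0, π / 3, 2 * π / 3} : Set ℝ),
      DifferentiableOn ℂ (F a) Complex.slitPlane ∧
      (∀ z : ℂ, 0 < z.im → 0 ≤ (F a z).im) ∧
      (∀ s : ℝ, 0 < s →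
        F a (s : ℂ) = (((1 + s) ^ (α / 2) * p (a + Real.arctan (1 / Real.sqrt s)) : ℝ) : ℂ))) →
    ∀ x y, p x = p y

/-- Card `jump-kernel-transverse-monotonicity`, FIRST LEMMA (the transfer `K RP_n ⇒ J RP_n` for the
stable pair, stated with the crux's own hypotheses on `(α, Φ, K)`): if the potential kernel `K` of
the symmetric stable generator with angular Lévy density `Φ` is invariant and reflection positive
for a mirror `n`, then so is the JUMP KERNEL `J(z) = ‖z‖^{-(3+α)} Φ(z/‖z‖)` itself.  (Mechanism: both
are equivalent to `s ↦ ψ_Φ(√s n + η)` being complete Bernstein for every `η ⊥ n`, via the 1D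
Lévy–Khintchine identity `ψ(pn+η) − ψ(η) = 2∫₀^∞ (1 − cos pt) A_η(t) dt`,
`A_η(t) = ∫_{n^⊥} cos(η·v) J(tn+v) dv`, and Bernstein's theorem: CBF ⇔ `A_η` completely monotone.) -/
def JumpKernelInheritsRP : Prop :=
  ∀ (α : ℝ) (Φ K : EuclideanSpace ℝ (Fin 3) → ℝ) (n : EuclideanSpace ℝ (Fin 3)),
    1 ≤ α → α < 2 → ContinuousOn Φ (Metric.sphere 0 1) →
    (∀ u ∈ Metric.sphere (0 : EuclideanSpace ℝ (Fin 3)) 1, 0 ≤ Φ u) →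
    (∃ u ∈ Metric.sphere (0 : EuclideanSpace ℝ (Fin 3)) 1, 0 < Φ u) → (∀ u, Φ (-u) = Φ u) →
    ContinuousOn K {0}ᶜ → (∀ x, x ≠ 0 → 0 < K x) →
    (∀ c : ℝ, 0 < c → ∀ x, K (c • x) = c ^ (α - 3) * K x) →
    (∀ f : EuclideanSpace ℝ (Fin 3) → ℝ, ContDiff ℝ 2 f → HasCompactSupport f → ∀ x,
      (∫ y, K (x - y) * ((1/2 : ℝ) * ∫ z, (f (y + z) + f (y - z) - 2 * f y) *
        (‖z‖ ^ (-(3 + α)) * Φ (‖z‖⁻¹ • z)))) = - f x) →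
    n ≠ 0 →
    (∀ x, K (((ℝ ∙ n)ᗮ).reflection x) = K x) →
    (∀ (m : ℕ) (p : Fin m → EuclideanSpace ℝ (Fin 3)) (c : Fin m → ℝ), (∀ a, 0 < inner ℝ (p a) n) →
      0 ≤ ∑ a, ∑ b, c a * c b * K (p a - ((ℝ ∙ n)ᗮ).reflection (p b))) →
    ∀ (m : ℕ) (p : Fin m → EuclideanSpace ℝ (Fin 3)) (c : Fin m → ℝ), (∀ a, 0 < inner ℝ (p a) n) →
      0 ≤ ∑ a, ∑ b, c a * c b *
        (‖p a - ((ℝ ∙ n)ᗮ).reflection (p b)‖ ^ (-(3 + α)) *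
          Φ (‖p a - ((ℝ ∙ n)ᗮ).reflection (p b)‖⁻¹ • (p a - ((ℝ ∙ n)ᗮ).reflection (p b))))

/-- Card `jump-kernel-transverse-monotonicity`, the m = 0 shadow of transverse complete
monotonicity (a cheap NECESSARY condition, directly on `Φ`): if `J` is reflection positive for the
mirror `n`, every slice `v ↦ J(t n + v)` (`t > 0`, `v ⊥ n`) is a positive-definite function on the
plane `n^⊥`; equivalently the gnomonic chart `w ↦ Φ(dir(n+w)) (1+‖w‖²)^{-(3+α)/2}` is positive
definite on `ℝ²`. Stated for finite configurations. -/
def SlicePositiveDefinite : Prop :=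
  ∀ (α : ℝ) (Φ : EuclideanSpace ℝ (Fin 3) → ℝ) (n : EuclideanSpace ℝ (Fin 3)), 0 < α → n ≠ 0 →
    (∀ (m : ℕ) (p : Fin m → EuclideanSpace ℝ (Fin 3)) (c : Fin m → ℝ), (∀ a, 0 < inner ℝ (p a) n) →
      0 ≤ ∑ a, ∑ b, c a * c b *
        (‖p a - ((ℝ ∙ n)ᗮ).reflection (p b)‖ ^ (-(3 + α)) *
          Φ (‖p a - ((ℝ ∙ n)ᗮ).reflection (p b)‖⁻¹ • (p a - ((ℝ ∙ n)ᗮ).reflection (p b))))) →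
    ∀ (t : ℝ), 0 < t → ∀ (m : ℕ) (v : Fin m → EuclideanSpace ℝ (Fin 3)) (c : Fin m → ℝ),
      (∀ a, inner ℝ (v a) n = 0) →
      0 ≤ ∑ a, ∑ b, c a * c b *
        (‖t • n + (v a - v b)‖ ^ (-(3 + α)) * Φ (‖t • n + (v a - v b)‖⁻¹ • (t • n + (v a - v b))))

end Summit.CriticalPhenomena.Ising3DConformalLimit.Cruxes.StableConeRPRigidity.Sketch

namespace Summit.CriticalPhenomena.Ising3DConformalLimit.Cruxes.StableConeRPRigidity.Sketch

open scoped BigOperators Real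
open MvPolynomial

/-- Card `wick-rotation-hyperbolicity`, FIRST LEMMA (the algebraic avatar of the crux). A real
homogeneous form `P` on `ℝ³`, positive off the origin, invariant under the nine lattice mirrors, all of
whose nine WICK ROTATIONS `λ ↦ P(λ·n + i·ξ)` (`ξ ⊥ n` real) have only real roots — i.e. `P(λn + iξ)` is
Gårding-hyperbolic in the direction `n` for each of the nine normals `n ∈ {e_i, e_i ± e_j}` — is a
constant multiple of a power of `k·k`.  (For `ψ = P^{α/m}` this real-rootedness is EQUIVALENT to the
nine mirror sections `s ↦ ψ(√s n + ξ)` being complete Bernstein, i.e. to nine-mirror RP of `K = 1/ψ`.) -/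
def WickHyperbolicityRigidity : Prop :=
  ∀ (m : ℕ) (P : MvPolynomial (Fin 3) ℝ), P.IsHomogeneous m →
    (∀ x : Fin 3 → ℝ, x ≠ 0 → 0 < MvPolynomial.eval x P) →
    (∀ i j : Fin 3, i ≠ j → ∀ x : Fin 3 → ℝ,
      MvPolynomial.eval (Function.update x i (-x i)) P = MvPolynomial.eval x P ∧
      MvPolynomial.eval (x ∘ Equiv.swap i j) P = MvPolynomial.eval x P ∧
      MvPolynomial.eval (Function.update (Function.update x i (-x j)) j (-x i)) P
        = MvPolynomial.eval x P) →
    (∀ n : Fin 3 → ℝ, (∃ i j : Fin 3, i ≠ j ∧ (n = Pi.single i 1 ∨ n = Pi.single i 1 + Pi.single j 1 ∨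
        n = Pi.single i 1 - Pi.single j 1)) →
      ∀ ξ : Fin 3 → ℝ, ∑ l, ξ l * n l = 0 → ∀ z : ℂ,
        MvPolynomial.aeval (fun l => z * (n l : ℂ) + Complex.I * (ξ l : ℂ)) P = 0 → z.im = 0) →
    ∃ (c : ℝ) (j : ℕ), P = MvPolynomial.C c * (∑ i : Fin 3, (MvPolynomial.X i) ^ 2) ^ j

/-- Card `wick-rotation-hyperbolicity`, the dictionary in the polynomial-power family (one mirror):
for `P` as above (degree `m ≥ 1`, `θ_n`-invariant, positive) and `0 < α < 2`, real-rootedness of the Wick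
rotation along `n` gives a complete-Bernstein (Pick on the slit plane, nonnegative on `(0,∞)`)
continuation of every section `s ↦ P(√s·n + ξ)^{α/m}`; the converse also holds (a root off the
imaginary axis is a branch point of `P(√s n+ξ)^{α/m}` inside `ℂ ∖ (−∞,0]`, multiplicities `≤ m/2 < m/α`). -/
def PolynomialPowerSectionsPick : Prop :=
  ∀ (m : ℕ) (P : MvPolynomial (Fin 3) ℝ) (α : ℝ) (n : Fin 3 → ℝ), 1 ≤ m → P.IsHomogeneous m →
    0 < α → α < 2 → n ≠ 0 →
    (∀ x : Fin 3 → ℝ, x ≠ 0 → 0 < MvPolynomial.eval x P) →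
    (∀ x : Fin 3 → ℝ, MvPolynomial.eval (x - (2 * (∑ l, x l * n l) / (∑ l, n l * n l)) • n) P
        = MvPolynomial.eval x P) →
    (∀ ξ : Fin 3 → ℝ, ∑ l, ξ l * n l = 0 → ∀ z : ℂ,
        MvPolynomial.aeval (fun l => z * (n l : ℂ) + Complex.I * (ξ l : ℂ)) P = 0 → z.im = 0) →
    ∀ ξ : Fin 3 → ℝ, ∑ l, ξ l * n l = 0 → ∃ F : ℂ → ℂ,
      DifferentiableOn ℂ F Complex.slitPlane ∧ (∀ w : ℂ, 0 < w.im → 0 ≤ (F w).im) ∧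
      ∀ s : ℝ, 0 < s →
        F (s : ℂ) = (((MvPolynomial.eval (fun l => Real.sqrt s * n l + ξ l) P) ^ (α / m) : ℝ) : ℂ)

end Summit.CriticalPhenomena.Ising3DConformalLimit.Cruxes.StableConeRPRigidity.Sketch
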